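import Literature.Topology.PlaneTopology.RectangleDuality
import HarnessLib

/-!
# Continua crossing a vertical strip, and the gap lemma

Topic: Topology / PlaneTopology.  Three more planar lemmas for the continuum form of the
Russo–Seymour–Welsh arguments (Schramm–Smirnov, *On the scaling limits of planar percolation*
(2011), proof of Lemma 6.1), complementing `RectangleDuality.lean`:

* `exists_subcontinuum_between_lines` — a compact connected set meeting the half planes
  `re ≤ a` and `re ≥ b` contains a compact connected subset of the closed strip `a ≤ re ≤ b`
  meeting both lines `re = a`, `re = b` (cut-wire theorem `exists_closed_separation`; compare
  `exists_subcontinuum_crossing` of `BandCrossing.lean`, the same for a perturbed rectangle).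
* `exists_subpath_crossing_levels` — from a path starting at height `≥ d` and ending at height
  `≤ c` (`c < d`) one extracts a sub-path running from height `d` to height `c` inside the
  horizontal band `c ≤ im ≤ d` (last visit to `im ≥ d`, next visit to `im ≤ c`).
* `exists_mem_gap_of_path` — **the gap lemma**: let `K ⊆ [x₀, w] × [y₀, y₁]` be compact
  connected, meeting the line `re = x₀` and containing a point `b` on the line `re = w ≤ x₁`;
  then every path in the vertical strip `x₀ ≤ re ≤ x₁` from height `≥ y₁` to height `< y₀`
  missing `K` passes through the half-open horizontal gap `(w, x₁] × {im b}` to the right of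
  `b` (apply the crossing lemma `exists_mem_of_isPreconnected_crossing` to `K ∪ [w, x₁] × {im b}`).
  In the percolation argument: a dual path descending past an open crossing of the narrower quad
  must use the thin strip between the two right sides, at the height of the crossing's endpoint.

## References

* O. Schramm, S. Smirnov, Ann. Probab. 39 (2011), proof of Lemma 6.1. [SchrammSmirnov2011]
* K. Kuratowski, *Topology* II (1968), §47.II Thm. 3 (cut-wire theorem).
-/

noncomputable section

namespace Literature.Topology.PlaneTopology

open Complex Set Metric Filter Function _root_.Topology

/-! ### A continuum crossing a strip contains a sub-continuum inside the strip -/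

/-- **Sub-continuum inside a vertical strip.**  If a compact connected `K ⊆ ℂ` meets
`{re ≤ a}` and `{re ≥ b}` (`a ≤ b`), then some compact connected `K' ⊆ K` lies in the closed
strip `{a ≤ re ≤ b}` and meets both lines `re = a` and `re = b`.  (If no connected subset of
`Z = K ∩ {a ≤ re ≤ b}` met both lines, the cut-wire theorem would split `Z = Z₁ ⊔ Z₂` with `Z₁`
off `re = b` and `Z₂` off `re = a`, and then `(K ∩ {re ≤ a}) ∪ Z₁`, `(K ∩ {re ≥ b}) ∪ Z₂` would
disconnect `K`.) [folklore] -/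
theorem exists_subcontinuum_between_lines {K : Set ℂ} {a b : ℝ} (hab : a ≤ b)
    (hK : IsCompact K) (hKc : IsPreconnected K) (hKa : ∃ z ∈ K, z.re ≤ a)
    (hKb : ∃ z ∈ K, b ≤ z.re) :
    ∃ K' ⊆ K, IsCompact K' ∧ IsPreconnected K' ∧ (∀ z ∈ K', a ≤ z.re ∧ z.re ≤ b) ∧
      (∃ z ∈ K', z.re = a) ∧ ∃ z ∈ K', z.re = b := by
  obtain ⟨za, hza, hzare⟩ := hKa
  obtain ⟨zb, hzb, hzbre⟩ := hKb
  rcases hab.eq_or_lt with rfl | hab'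
  · -- `a = b`: a single point of `K` on the line `re = a`
    obtain ⟨z, hz, hzre⟩ : a ∈ re '' K :=
      hKc.intermediate_value hza hzb continuous_re.continuousOn ⟨hzare, hzbre⟩
    refine ⟨{z}, singleton_subset_iff.2 hz, isCompact_singleton, isPreconnected_singleton,
      fun w hw => ?_, ⟨z, rfl, hzre⟩, ⟨z, rfl, hzre⟩⟩
    rw [mem_singleton_iff.1 hw, hzre]
    exact ⟨le_rfl, le_rfl⟩
  set Z : Set ℂ := K ∩ {z | a ≤ z.re ∧ z.re ≤ b} with hZ
  have hZc : IsCompact Z := hK.inter_right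
    ((isClosed_le continuous_const continuous_re).inter (isClosed_le continuous_re continuous_const))
  by_cases h : ∃ C ⊆ Z, IsPreconnected C ∧ (∃ z ∈ C, z.re = a) ∧ ∃ z ∈ C, z.re = b
  · obtain ⟨C, hCZ, hCc, ⟨u, hu, hure⟩, ⟨v, hv, hvre⟩⟩ := h
    have hcl : closure C ⊆ Z := closure_minimal hCZ hZc.isClosed
    exact ⟨closure C, hcl.trans inter_subset_left, hZc.of_isClosed_subset isClosed_closure hcl,
      hCc.closure, fun z hz => (hcl hz).2, ⟨u, subset_closure hu, hure⟩,
      ⟨v, subset_closure hv, hvre⟩⟩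
  · exfalso
    obtain ⟨Z₁, Z₂, hZ₁, hZ₂, hdisj, hunion, hZ₁b, hZ₂a⟩ :=
      exists_closed_separation (A := {z : ℂ | z.re = a}) (B := {z : ℂ | z.re = b}) hZc
        (isClosed_eq continuous_re continuous_const) (isClosed_eq continuous_re continuous_const)
        (fun C hC hCc hCa hCb => h ⟨C, hC, hCc, hCa, hCb⟩)
    have hZ₁sub : Z₁ ⊆ Z := hunion ▸ subset_union_left
    have hZ₂sub : Z₂ ⊆ Z := hunion ▸ subset_union_right
    set U₁ : Set ℂ := (K ∩ {z | z.re ≤ a}) ∪ Z₁ with hU₁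
    set U₂ : Set ℂ := (K ∩ {z | b ≤ z.re}) ∪ Z₂ with hU₂
    have hU₁c : IsClosed U₁ :=
      (hK.isClosed.inter (isClosed_le continuous_re continuous_const)).union hZ₁
    have hU₂c : IsClosed U₂ :=
      (hK.isClosed.inter (isClosed_le continuous_const continuous_re)).union hZ₂
    have hcover : K ⊆ U₁ ∪ U₂ := fun z hz => by
      by_cases h1 : z.re ≤ a
      · exact Or.inl (Or.inl ⟨hz, h1⟩)
      by_cases h2 : b ≤ z.re
      · exact Or.inr (Or.inl ⟨hz, h2⟩)
      have hzZ : z ∈ Z := ⟨hz, (not_le.1 h1).le, (not_le.1 h2).le⟩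
      rw [← hunion] at hzZ
      rcases hzZ with hz1 | hz2
      · exact Or.inl (Or.inr hz1)
      · exact Or.inr (Or.inr hz2)
    obtain ⟨z, -, hz₁, hz₂⟩ := isPreconnected_closed_iff.1 hKc U₁ U₂ hU₁c hU₂c hcover
      ⟨za, hza, Or.inl ⟨hza, hzare⟩⟩ ⟨zb, hzb, Or.inl ⟨hzb, hzbre⟩⟩
    rcases hz₁ with ⟨-, hz₁⟩ | hz₁ <;> rcases hz₂ with ⟨-, hz₂⟩ | hz₂
    · exact absurd (hz₂.trans hz₁) (not_le.2 hab')
    · exact Set.disjoint_left.1 hZ₂a hz₂ (show z.re = a from le_antisymm hz₁ (hZ₂sub hz₂).2.1)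
    · exact Set.disjoint_left.1 hZ₁b hz₁ (show z.re = b from le_antisymm (hZ₁sub hz₁).2.2 hz₂)
    · exact Set.disjoint_left.1 hdisj hz₁ hz₂

/-! ### Extracting a sub-path crossing a horizontal band -/

/-- **Sub-path crossing a band.**  Let `g : ℝ → ℂ` be continuous with `im (g 0) ≥ d` and
`im (g 1) ≤ c`, `c < d`.  Then for some `0 ≤ t₁ < t₂ ≤ 1`: `im (g t₁) = d`, `im (g t₂) = c`, and
`c ≤ im (g t) ≤ d` on `[t₁, t₂]` (`t₁` = last visit to `im ≥ d`, `t₂` = next visit to `im ≤ c`).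
[folklore] -/
theorem exists_subpath_crossing_levels {g : ℝ → ℂ} (hg : Continuous g) {c d : ℝ} (hcd : c < d)
    (h0 : d ≤ (g 0).im) (h1 : (g 1).im ≤ c) :
    ∃ t₁ t₂ : ℝ, 0 ≤ t₁ ∧ t₁ < t₂ ∧ t₂ ≤ 1 ∧ (g t₁).im = d ∧ (g t₂).im = c ∧
      ∀ t, t₁ ≤ t → t ≤ t₂ → c ≤ (g t).im ∧ (g t).im ≤ d := by
  set f : ℝ → ℝ := fun t => (g t).im with hf
  have hfc : Continuous f := continuous_im.comp hg
  set T₁ : Set ℝ := Icc 0 1 ∩ {t | d ≤ f t} with hT₁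
  have hT₁c : IsClosed T₁ := isClosed_Icc.inter (isClosed_le continuous_const hfc)
  have hT₁ne : T₁.Nonempty := ⟨0, ⟨le_rfl, zero_le_one⟩, h0⟩
  have hT₁bdd : BddAbove T₁ := ⟨1, fun t ht => ht.1.2⟩
  set t₁ := sSup T₁ with ht₁
  have ht₁mem : t₁ ∈ T₁ := hT₁c.csSup_mem hT₁ne hT₁bdd
  have ht₁I : t₁ ∈ Icc (0 : ℝ) 1 := ht₁mem.1
  have hafter₁ : ∀ t, t₁ < t → t ≤ 1 → f t < d := fun t ht ht1 => by
    by_contra hge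
    push Not at hge
    exact not_le.2 ht (le_csSup hT₁bdd ⟨⟨ht₁I.1.trans ht.le, ht1⟩, hge⟩)
  have hft₁ : f t₁ = d := by
    have hmem : d ∈ Icc (f 1) (f t₁) := ⟨h1.trans hcd.le, ht₁mem.2⟩
    obtain ⟨s, hs, hfs⟩ := intermediate_value_Icc' ht₁I.2 hfc.continuousOn hmem
    have hsT : s ∈ T₁ := ⟨⟨ht₁I.1.trans hs.1, hs.2⟩, hfs.ge⟩
    have hst : s = t₁ := le_antisymm (le_csSup hT₁bdd hsT) hs.1
    rw [← hst, hfs]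
  set T₂ : Set ℝ := Icc t₁ 1 ∩ {t | f t ≤ c} with hT₂
  have hT₂c : IsClosed T₂ := isClosed_Icc.inter (isClosed_le hfc continuous_const)
  have hT₂ne : T₂.Nonempty := ⟨1, ⟨ht₁I.2, le_rfl⟩, h1⟩
  have hT₂bdd : BddBelow T₂ := ⟨t₁, fun t ht => ht.1.1⟩
  set t₂ := sInf T₂ with ht₂
  have ht₂mem : t₂ ∈ T₂ := hT₂c.csInf_mem hT₂ne hT₂bdd
  have ht₁₂ : t₁ ≤ t₂ := ht₂mem.1.1
  have ht₂1 : t₂ ≤ 1 := ht₂mem.1.2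
  have hbefore₂ : ∀ t, t₁ ≤ t → t < t₂ → c < f t := fun t ht ht' => by
    by_contra hle
    push Not at hle
    exact not_le.2 ht' (csInf_le hT₂bdd ⟨⟨ht, ht'.le.trans ht₂1⟩, hle⟩)
  have hft₂ : f t₂ = c := by
    have hmem : c ∈ Icc (f t₂) (f t₁) := ⟨ht₂mem.2, by rw [hft₁]; exact hcd.le⟩
    obtain ⟨s, hs, hfs⟩ := intermediate_value_Icc' ht₁₂ hfc.continuousOn hmem
    have hsT : s ∈ T₂ := ⟨⟨hs.1, hs.2.trans ht₂1⟩, hfs.le⟩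
    have hst : s = t₂ := le_antisymm hs.2 (csInf_le hT₂bdd hsT)
    rw [← hst, hfs]
  have hlt : t₁ < t₂ := by
    rcases ht₁₂.lt_or_eq with h | h
    · exact h
    · exfalso
      have : f t₁ = c := by rw [h, hft₂]
      linarith [hft₁]
  refine ⟨t₁, t₂, ht₁I.1, hlt, ht₂1, hft₁, hft₂, fun t h1 h2 => ⟨?_, ?_⟩⟩
  · rcases h2.lt_or_eq with h2 | rfl
    · exact (hbefore₂ t h1 h2).le
    · exact hft₂.ge
  · rcases h1.lt_or_eq with h1 | rfl
    · exact (hafter₁ t h1 (h2.trans ht₂1)).le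
    · exact hft₁.le

/-! ### The gap lemma -/

/-- Horizontal segments `[w, x₁] × {y}` are convex. [folklore] -/
theorem convex_Icc_reProdIm_singleton (w x₁ y : ℝ) : Convex ℝ (Icc w x₁ ×ℂ ({y} : Set ℝ)) := by
  rw [← (convex_Icc (𝕜 := ℝ) w x₁).convexHull_eq, ← (convex_singleton (𝕜 := ℝ) y).convexHull_eq,
    ← Complex.convexHull_reProdIm]
  exact convex_convexHull ℝ _

/-- **The gap lemma.**  Let `K ⊆ [x₀, w] × [y₀, y₁]` be compact and connected, meeting the line
`re = x₀` and containing the point `b` with `re b = w`, where `w ≤ x₁`.  Let `P : [0, 1] → ℂ` be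
a path in the vertical strip `x₀ ≤ re ≤ x₁` with `im (P 0) ≥ y₁`, `im (P 1) < y₀`, missing
`K`.  Then `P` meets the half-open horizontal gap `(w, x₁] × {im b}`.  Proof: reparametrise the
sub-path of `P` crossing the band `im (P 1) ≤ im ≤ y₁` (`exists_subpath_crossing_levels`) to a
bottom-to-top path of the rectangle `[x₀, x₁] × [im (P 1), y₁]` and apply the crossing lemma to
the continuum `K ∪ [w, x₁] × {im b}`; the common point is not in `K`, so it lies on the segment
with `re > w`. [cite: SchrammSmirnov2011, proof of Lemma 6.1] -/
theorem exists_mem_gap_of_path {K : Set ℂ} {P : ℝ → ℂ} {x₀ w x₁ y₀ y₁ : ℝ} (hxw : x₀ ≤ w)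
    (hwx : w ≤ x₁) (hK : IsCompact K) (hKc : IsPreconnected K)
    (hKsub : K ⊆ Icc x₀ w ×ℂ Icc y₀ y₁) (hKa : ∃ z ∈ K, z.re = x₀) {b : ℂ} (hb : b ∈ K)
    (hbre : b.re = w) (hP : ContinuousOn P (Icc 0 1))
    (hPre : ∀ t ∈ Icc (0 : ℝ) 1, x₀ ≤ (P t).re ∧ (P t).re ≤ x₁)
    (hP0 : y₁ ≤ (P 0).im) (hP1 : (P 1).im < y₀) (hPK : ∀ t ∈ Icc (0 : ℝ) 1, P t ∉ K) :
    ∃ t ∈ Icc (0 : ℝ) 1, (P t).im = b.im ∧ w < (P t).re ∧ (P t).re ≤ x₁ := by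
  have hbim : y₀ ≤ b.im ∧ b.im ≤ y₁ := by
    have h := hKsub hb
    rw [mem_reProdIm, mem_Icc, mem_Icc] at h
    exact h.2
  set c : ℝ := (P 1).im with hc
  have hcy : c < y₀ := hP1
  -- the continuum `Kh = K ∪ [w, x₁] × {im b}`
  set seg : Set ℂ := Icc w x₁ ×ℂ ({b.im} : Set ℝ) with hseg
  set Kh : Set ℂ := K ∪ seg with hKh
  have hsegc : IsCompact seg := Metric.isCompact_of_isClosed_isBounded
    (isClosed_Icc.reProdIm isClosed_singleton)
    ((isBounded_Icc _ _).reProdIm Bornology.isBounded_singleton)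
  have hbseg : b ∈ seg := by
    rw [hseg, mem_reProdIm, mem_Icc, mem_singleton_iff]
    exact ⟨⟨hbre.ge, hbre.le.trans hwx⟩, rfl⟩
  have hKhc : IsCompact Kh := hK.union hsegc
  have hKhconn : IsPreconnected Kh :=
    IsPreconnected.union b hb hbseg hKc (convex_Icc_reProdIm_singleton w x₁ b.im).isPreconnected
  have hKhsub : Kh ⊆ Icc x₀ x₁ ×ℂ Icc c y₁ := by
    rintro z (hz | hz)
    · have h := hKsub hz
      rw [mem_reProdIm, mem_Icc, mem_Icc] at h ⊢
      exact ⟨⟨h.1.1, h.1.2.trans hwx⟩, ⟨by linarith [h.2.1], h.2.2⟩⟩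
    · rw [hseg, mem_reProdIm, mem_Icc, mem_singleton_iff] at hz
      rw [mem_reProdIm, mem_Icc, mem_Icc, hz.2]
      exact ⟨⟨hxw.trans hz.1.1, hz.1.2⟩, ⟨by linarith [hbim.1], hbim.2⟩⟩
  have hre_im : ∀ x y : ℝ, (((x : ℝ) : ℂ) + ((y : ℝ) : ℂ) * I).re = x ∧
      (((x : ℝ) : ℂ) + ((y : ℝ) : ℂ) * I).im = y := fun x y => by
    constructor <;> simp
  have hKhb : ∃ z ∈ Kh, z.re = x₁ := by
    refine ⟨((x₁ : ℝ) : ℂ) + ((b.im : ℝ) : ℂ) * I, Or.inr ?_, (hre_im _ _).1⟩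
    rw [hseg, mem_reProdIm, mem_Icc, mem_singleton_iff, (hre_im _ _).1, (hre_im _ _).2]
    exact ⟨⟨hwx, le_rfl⟩, rfl⟩
  have hKha : ∃ z ∈ Kh, z.re = x₀ := by
    obtain ⟨z, hz, hzre⟩ := hKa
    exact ⟨z, Or.inl hz, hzre⟩
  -- the sub-path of `P` crossing the band `c ≤ im ≤ y₁`
  set g : ℝ → ℂ := fun t => P ((projIcc (0 : ℝ) 1 zero_le_one t : Icc (0 : ℝ) 1) : ℝ) with hg
  have hgc : Continuous g :=
    hP.comp_continuous (continuous_subtype_val.comp continuous_projIcc)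
      fun t => (projIcc (0 : ℝ) 1 zero_le_one t).2
  have hgP : ∀ t ∈ Icc (0 : ℝ) 1, g t = P t := fun t ht => by
    simp only [hg, projIcc_of_mem zero_le_one ht]
  have hg0 : y₁ ≤ (g 0).im := by rw [hgP 0 ⟨le_rfl, zero_le_one⟩]; exact hP0
  have hg1 : (g 1).im ≤ c := by rw [hgP 1 ⟨zero_le_one, le_rfl⟩]
  obtain ⟨t₁, t₂, ht₁0, ht₁₂, ht₂1, hgt₁, hgt₂, hband⟩ :=
    exists_subpath_crossing_levels hgc (hcy.trans_le (hbim.1.trans hbim.2)) hg0 hg1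
  -- reparametrised from the bottom (`t₂`) to the top (`t₁`)
  set γ : ℝ → ℂ := fun u => g (t₂ + (t₁ - t₂) * u) with hγ
  have hmemI : ∀ u ∈ Icc (0 : ℝ) 1, t₁ ≤ t₂ + (t₁ - t₂) * u ∧ t₂ + (t₁ - t₂) * u ≤ t₂ := by
    intro u hu
    rw [mem_Icc] at hu
    constructor <;> nlinarith [hu.1, hu.2, ht₁₂]
  have hmem01 : ∀ u ∈ Icc (0 : ℝ) 1, t₂ + (t₁ - t₂) * u ∈ Icc (0 : ℝ) 1 := fun u hu =>
    ⟨ht₁0.trans (hmemI u hu).1, (hmemI u hu).2.trans ht₂1⟩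
  have hγc : Continuous γ := hgc.comp (by fun_prop)
  have hγmaps : MapsTo γ (Icc 0 1) (Icc x₀ x₁ ×ℂ Icc c y₁) := fun u hu => by
    obtain ⟨h1, h2⟩ := hband _ (hmemI u hu).1 (hmemI u hu).2
    have hre := hPre _ (hmem01 u hu)
    rw [← hgP _ (hmem01 u hu)] at hre
    rw [mem_reProdIm, mem_Icc, mem_Icc]
    exact ⟨hre, ⟨h1, h2⟩⟩
  have hγ0 : (γ 0).im = c := by
    show (g (t₂ + (t₁ - t₂) * 0)).im = c
    rw [mul_zero, add_zero, hgt₂]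
  have hγ1 : (γ 1).im = y₁ := by
    show (g (t₂ + (t₁ - t₂) * 1)).im = y₁
    rw [mul_one, add_sub_cancel, hgt₁]
  obtain ⟨u, hu, huK⟩ := exists_mem_of_isPreconnected_crossing (hxw.trans hwx)
    (hcy.le.trans (hbim.1.trans hbim.2)) hKhc hKhconn hKhsub hKha hKhb hγc.continuousOn hγmaps
    hγ0 hγ1
  -- the common point is on the segment, strictly to the right of `b`
  set s : ℝ := t₂ + (t₁ - t₂) * u with hs
  have hsI : s ∈ Icc (0 : ℝ) 1 := hmem01 u hu
  have hγu : γ u = P s := hgP s hsI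
  rw [hγu] at huK
  refine ⟨s, hsI, ?_⟩
  rcases huK with hPK' | hPs
  · exact absurd hPK' (hPK s hsI)
  · rw [hseg, mem_reProdIm, mem_Icc, mem_singleton_iff] at hPs
    refine ⟨hPs.2, ?_, hPs.1.2⟩
    rcases hPs.1.1.lt_or_eq with hlt | heq
    · exact hlt
    · exfalso
      refine hPK s hsI ?_
      have : P s = b := Complex.ext (by rw [← heq, hbre]) (by rw [hPs.2])
      rw [this]
      exact hb

end Literature.Topology.PlaneTopology
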